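import Mathlib
import Literature.NumberTheory.LFunctions.Zhang2022.Section5VerticalShift
import Literature.Analysis.Complex.HolomorphicPrimitives
import Literature.NumberTheory.Sieve.LargeSieveCharacters
import HarnessLib

/-!
# Zhang (2022), §2 p. 5 and Lemma 5.2: `|Z(½+it,θ)| = 1`, the analytic square root
# `Y(s,θ)² = Z(s,θ)⁻¹` on the upper half-plane, `Y′/Y = −½Z′/Z`, and the vertical shift of `Y`,
# kernel-checked

Topic `Literature/NumberTheory/LFunctions/Zhang2022` (Landau–Siegel autopsy tree; verdict-neutral).
Y. Zhang, *Discrete mean estimates and the Landau–Siegel zero*, arXiv:2211.02515v1 (2022) — **an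
unrefereed manuscript, a claimed result under adjudication** (cell pub-zhang: audit + repair census
of arXiv:2211.02515; no claim about Landau–Siegel) — §2, p. 5:

> Assume `ψ ∈ Ψ`. Recall that the functional equation for `L(s,ψ)` is given by (2.2) with `θ = ψ`.
> On the upper-half plane, since `Z(s,ψ)` is analytic and non-vanishing, there is an analytic
> function `Y(s,ψ)` such that `Y(s,ψ)² = Z(s,ψ)⁻¹`. Let `M(s,ψ) = Y(s,ψ)L(s,ψ)`. Note that `M(s,ψ)`
> is defined for `t > 0` only, and, for each `ψ`, there are two choices of `M(s,ψ)` up to `±` […].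
> The functional equation (2.2) gives `M(s,ψ) = Y(s,ψ)⁻¹L(1−s,ψ̄)`. Since `|Y(1/2+it,ψ)| = 1`, it
> follows that `|M(1/2+it,ψ)| = |L(1/2+it,ψ)|`, `M(1/2+it,ψ) ∈ ℝ` (2.11) […].

and §5, p. 10, proof of Lemma 5.2:

> By (2.6) and the Stirling formula, for `|w| < 5α`,
> `(Y′/Y)(s+w,ψ) = −½(Z′/Z)(s+w,ψ) = ½log(pt₀) + O(ι^{−114})`. Hence, for `1 ≤ j ≤ 3`,
> `Y(s+β_j,ψ)/Y(s,ψ) = exp(∫₀^{β_j}(Y′/Y)(s+w,ψ)dw) = (pt₀)^{β_j/2}(1 + O(ι^{−123}))`.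
> The result now follows since `(β₁+β₂+β₃)/2 = β₃`.

This file PROVES, for a primitive character `θ` to an arbitrary modulus `k ≥ 1` (the analytic and
zero-free input being `GammaFactor.analyticAt_Zfac` / `GammaFactor.Zfac_ne_zero` of
`Section5VerticalShift`, i.e. the exact form (2.4)):

* `norm_Zfac_half_eq_one` — `|Z(½+it,θ)| = 1` for `t > 0` (from (2.4) EXACT: `|θ(−1)| = 1`,
  `|τ(θ)| = √k` (the tree's `LargeSieve.norm_gaussSum_sq`), `|k^{−s}| = k^{−1/2}`,
  `|ϑ(½+it)| = 1` (the tree's `SiegelIntegral.norm_rsChi_half`), and for odd `θ`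
  `|i cot(πs/2)| = |(1+q)/(1−q)| = 1` since `q = e^{iπs} = ie^{−πt}` is purely imaginary);
* `exists_sqrt_inv_Zfac` — existence of an analytic `Y` on `{Im s > 0}` with `Y² = Z(·,θ)⁻¹`
  (the tree's `Complex.exists_sq_eq_of_compl`, Conway VIII.2.2 (c) ⇒ (h): the half-plane is open
  and convex and its complement has no bounded component);
* `sqrt_inv_Zfac_eq_or_eq_neg` — "two choices up to `±`": two continuous square roots agree up to a
  global sign (Mathlib's `IsPreconnected.eq_or_eq_neg_of_sq_eq`);
* `norm_sqrt_inv_Zfac_half_eq_one` — "`|Y(½+it,ψ)| = 1`";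
* `norm_logDeriv_Zfac_add_log_le` — Lemma 5.1's second display, pointwise:
  `‖(Z′/Z)(σ+i(t+y),θ) + log(kt/2π)‖ ≤ (2|y|+4A+10)/t` (`1 ≤ A`, `0 < σ ≤ A`, `t ≥ 4A`, `|y| ≤ t/2`);
* `logDeriv_sqrt_inv_Zfac` — `Y′/Y = −½Z′/Z` on the upper half-plane;
* `sqrt_inv_Zfac_vertical_shift` — `Y(σ+it+iv) = Y(σ+it)·e^{iv·log(kt/2π)/2}·e^{η}`,
  `‖η‖ ≤ (2|v|+4A+10)|v|/(2t)` (same route as `GammaFactor.Zfac_vertical_shift`);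
* `sqrt_inv_Zfac_triple_shift` — the product of Lemma 5.2 for three imaginary shifts:
  `Y(s+iv₁)Y(s+iv₂)Y(s+iv₃)/Y(s) = Z(s,θ)⁻¹·e^{i(v₁+v₂+v₃)log(kt/2π)/2}·e^{η}`,
  `‖η‖ ≤ Σ_j (2|v_j|+4A+10)|v_j|/(2t)`.

Not restated: the functional equation (2.2), `M(s,ψ)`, (2.11)–(2.12) (they involve `L(s,ψ)`);
Lemma 5.2 as printed (`β_j` of (2.13), `(pt₀)^{β₃}`, `ι^{−123}`) is the bookkeeping consequence of
`sqrt_inv_Zfac_triple_shift` under the manuscript's parameter conventions, which are not introduced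
here. Nothing about Theorems 1–2 of the source is stated or implied; nothing here bears on the
cell's verdict on (8.24).

## References

* Y. Zhang, arXiv:2211.02515v1 (2022), §2 p. 5 (the paragraph before (2.11)); §5 p. 10,
  Lemma 5.2 and its proof. [cite: Zhang2022LandauSiegel, §2 p. 5; §5 Lemma 5.2 (proof)]
* J. B. Conway, *Functions of One Complex Variable I*, 2nd ed. (1978), Thm. VIII.2.2
  (square roots on simply connected regions; consumed via the tree's `HolomorphicPrimitives`).
  [cite: Conway1978, Thm. VIII.2.2]
-/

noncomputable section

open Complex Real Filter _root_.Topology Set MeasureTheory intervalIntegral ComplexConjugate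

namespace Literature.NumberTheory.LFunctions.Zhang2022.GammaFactor

variable {k : ℕ} [NeZero k]

/-! ### §2 p. 5: `|Z(½+it,θ)| = 1` and the analytic square root `Y(s,θ)² = Z(s,θ)⁻¹` -/

/-- `|Z(½ + it, θ)| = 1` for a primitive `θ` and `t > 0` (so that `|Y(½+it,ψ)| = 1`, §2 p. 5):
from the exact form (2.4) — `|θ(−1)| = 1`, `|τ(θ)| = √k`, `|k^{−s}| = k^{−1/2}`, `|ϑ(½+it)| = 1`
(the tree's `SiegelIntegral.norm_rsChi_half`), and `|i cot(π s/2)| = |(1+q)/(1−q)| = 1` because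
`q = e^{iπs} = ie^{−πt}` is purely imaginary. [cite: Zhang2022LandauSiegel, §2 p. 5] -/
theorem norm_Zfac_half_eq_one {θ : DirichletCharacter ℂ k} (hθ : θ.IsPrimitive) {t : ℝ}
    (ht : 0 < t) : ‖Zfac θ (1 / 2 + t * I)‖ = 1 := by
  have him : ((1 : ℂ) / 2 + t * I).im = t := by simp
  have hs : 0 < ((1 : ℂ) / 2 + t * I).im := by rw [him]; exact ht
  have hk0 : (0 : ℝ) < k := Nat.cast_pos.mpr (Nat.pos_of_ne_zero (NeZero.ne k))
  have h1 : ‖θ (-1)‖ = 1 := by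
    have hsq : θ (-1) * θ (-1) = 1 := by rw [← map_mul, neg_mul_neg, one_mul, map_one]
    have h := congrArg (fun z : ℂ => ‖z‖) hsq
    simp only [norm_mul, norm_one] at h
    nlinarith [norm_nonneg (θ (-1))]
  have h2 : ‖tau θ‖ = Real.sqrt k := by
    rw [← Real.sqrt_sq (norm_nonneg (tau θ)), tau,
      Literature.NumberTheory.Sieve.LargeSieve.norm_gaussSum_sq hθ]
  have h3 : ‖(k : ℂ) ^ (-((1 : ℂ) / 2 + t * I))‖ = (k : ℝ) ^ (-(1 / 2 : ℝ)) := by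
    rw [Complex.norm_natCast_cpow_of_pos (Nat.pos_of_ne_zero (NeZero.ne k))]
    congr 1
    simp
  have h4 : ‖vartheta ((1 : ℂ) / 2 + t * I)‖ = 1 := by
    rw [vartheta_eq_rsChi (by rw [him]; exact ht.ne')]
    exact SiegelIntegral.norm_rsChi_half t
  have h5 : ‖1 + corr θ ((1 : ℂ) / 2 + t * I)‖ = 1 := by
    by_cases hev : θ.Even
    · rw [corr, if_pos hev, add_zero, norm_one]
    · have hcot : 1 + corr θ ((1 : ℂ) / 2 + t * I)
          = (1 + qexp ((1 : ℂ) / 2 + t * I)) / (1 - qexp ((1 : ℂ) / 2 + t * I)) := by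
        rw [corr, if_neg hev, ← I_mul_cot_eq hs]; ring
      have harg : (π : ℂ) * ((1 : ℂ) / 2 + (t : ℂ) * I) * I = -(π : ℂ) * t + (π / 2 : ℂ) * I := by
        linear_combination (π : ℂ) * t * I_sq
      have hq : qexp ((1 : ℂ) / 2 + t * I) = ((Real.exp (-π * t) : ℝ) : ℂ) * I := by
        rw [qexp, harg, Complex.exp_add, Complex.exp_mul_I, Complex.cos_pi_div_two,
          Complex.sin_pi_div_two, Complex.ofReal_exp]
        push_cast
        ring
      have hconj : 1 - qexp ((1 : ℂ) / 2 + t * I) = conj (1 + qexp ((1 : ℂ) / 2 + t * I)) := by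
        rw [hq, map_add, map_one, map_mul, Complex.conj_ofReal, Complex.conj_I]
        ring
      have hne : 1 - qexp ((1 : ℂ) / 2 + t * I) ≠ 0 := one_sub_qexp_ne_zero hs
      have hne' : ‖1 + qexp ((1 : ℂ) / 2 + t * I)‖ ≠ 0 := by
        rw [← Complex.norm_conj, ← hconj]; exact norm_ne_zero_iff.mpr hne
      rw [hcot, norm_div, hconj, Complex.norm_conj]
      exact div_self hne'
  rw [Zfac_eq θ hs, norm_mul, norm_mul, norm_mul, norm_mul, h1, h2, h3, h4, h5, one_mul, mul_one,
    mul_one, Real.sqrt_eq_rpow, ← Real.rpow_add hk0]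
  norm_num


/-- **§2 p. 5, the analytic square root `Y`**: "On the upper-half plane, since `Z(s,ψ)` is analytic
and non-vanishing, there is an analytic function `Y(s,ψ)` such that `Y(s,ψ)² = Z(s,ψ)⁻¹`." Here for
any primitive `θ`: the upper half-plane is open, convex and its complement has no bounded
component, so the tree's `Complex.exists_sq_eq_of_compl` (Conway VIII.2.2 (c) ⇒ (h)) applies to
`Z(·,θ)⁻¹`. [cite: Zhang2022LandauSiegel, §2 p. 5] -/
theorem exists_sqrt_inv_Zfac {θ : DirichletCharacter ℂ k} (hθ : θ.IsPrimitive) :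
    ∃ Y : ℂ → ℂ, DifferentiableOn ℂ Y {s : ℂ | 0 < s.im} ∧
      ∀ s : ℂ, 0 < s.im → Y s ^ 2 = (Zfac θ s)⁻¹ := by
  have hUo : IsOpen {s : ℂ | 0 < s.im} := isOpen_lt continuous_const Complex.continuous_im
  have hUc : IsPreconnected {s : ℂ | 0 < s.im} := (convex_halfSpace_im_gt 0).isPreconnected
  have hUh : ∀ a ∈ {s : ℂ | 0 < s.im}ᶜ, ¬ Bornology.IsBounded (connectedComponentIn {s : ℂ | 0 < s.im}ᶜ a) := by
    intro a ha hB
    have hcompl : {s : ℂ | 0 < s.im}ᶜ = {s : ℂ | s.im ≤ 0} := by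
      ext z; simp [not_lt]
    rw [hcompl] at ha hB
    -- the whole closed lower half-plane is connected and unbounded, and it is `a`'s component
    have hconn : IsPreconnected {s : ℂ | s.im ≤ 0} := (convex_halfSpace_im_le 0).isPreconnected
    have hsub : {s : ℂ | s.im ≤ 0} ⊆ connectedComponentIn {s : ℂ | s.im ≤ 0} a :=
      hconn.subset_connectedComponentIn ha (subset_refl _)
    obtain ⟨R, hR⟩ := (hB.subset hsub).subset_closedBall 0
    have hmem : (-(((|R| + 1 : ℝ) : ℂ) * I)) ∈ {s : ℂ | s.im ≤ 0} := by
      simp only [Set.mem_setOf_eq, Complex.neg_im, Complex.mul_im, Complex.ofReal_re, Complex.I_im,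
        Complex.ofReal_im, Complex.I_re, mul_zero, add_zero, mul_one, neg_nonpos]
      positivity
    have h := hR hmem
    rw [Metric.mem_closedBall, dist_zero_right, norm_neg, norm_mul, Complex.norm_I, mul_one,
      Complex.norm_real, Real.norm_of_nonneg (by positivity)] at h
    linarith [le_abs_self R]
  have hd : DifferentiableOn ℂ (fun s => (Zfac θ s)⁻¹) {s : ℂ | 0 < s.im} := fun s hs =>
    ((differentiableAt_Zfac θ hs).inv (Zfac_ne_zero hθ hs)).differentiableWithinAt
  have h0 : ∀ s ∈ {s : ℂ | 0 < s.im}, (Zfac θ s)⁻¹ ≠ 0 := fun s hs =>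
    inv_ne_zero (Zfac_ne_zero hθ hs)
  obtain ⟨Y, hY, hY2⟩ := Complex.exists_sq_eq_of_compl hUo hUc hUh hd h0
  exact ⟨Y, hY, fun s hs => hY2 s hs⟩

/-- "Since `|Y(½+it,ψ)| = 1`" (§2 p. 5): any `Y` with `Y² = Z(·,θ)⁻¹` on the upper half-plane has
modulus one on the critical line (`norm_Zfac_half_eq_one`). [cite: Zhang2022LandauSiegel, §2 p. 5] -/
theorem norm_sqrt_inv_Zfac_half_eq_one {θ : DirichletCharacter ℂ k} (hθ : θ.IsPrimitive)
    {Y : ℂ → ℂ} (hY : ∀ s : ℂ, 0 < s.im → Y s ^ 2 = (Zfac θ s)⁻¹) {t : ℝ} (ht : 0 < t) :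
    ‖Y (1 / 2 + t * I)‖ = 1 := by
  have hs : 0 < ((1 : ℂ) / 2 + t * I).im := by simpa using ht
  have h := congrArg (fun z : ℂ => ‖z‖) (hY _ hs)
  simp only [norm_pow, norm_inv, norm_Zfac_half_eq_one hθ ht, inv_one] at h
  nlinarith [norm_nonneg (Y (1 / 2 + t * I))]


/-- "for each `ψ`, there are two choices … up to `±`" (§2 p. 5): two analytic (indeed two
continuous) square roots of `Z(·,θ)⁻¹` on the upper half-plane agree up to a global sign, the
half-plane being connected. [cite: Zhang2022LandauSiegel, §2 p. 5] -/
theorem sqrt_inv_Zfac_eq_or_eq_neg {θ : DirichletCharacter ℂ k} (hθ : θ.IsPrimitive)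
    {Y₁ Y₂ : ℂ → ℂ} (h₁ : DifferentiableOn ℂ Y₁ {s : ℂ | 0 < s.im})
    (h₂ : DifferentiableOn ℂ Y₂ {s : ℂ | 0 < s.im})
    (hY₁ : ∀ s : ℂ, 0 < s.im → Y₁ s ^ 2 = (Zfac θ s)⁻¹)
    (hY₂ : ∀ s : ℂ, 0 < s.im → Y₂ s ^ 2 = (Zfac θ s)⁻¹) :
    Set.EqOn Y₁ Y₂ {s : ℂ | 0 < s.im} ∨ Set.EqOn Y₁ (-Y₂) {s : ℂ | 0 < s.im} := by
  have hUc : IsPreconnected {s : ℂ | 0 < s.im} := (convex_halfSpace_im_gt 0).isPreconnected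
  refine hUc.eq_or_eq_neg_of_sq_eq h₁.continuousOn h₂.continuousOn ?_ ?_
  · intro s hs
    simp only [Pi.pow_apply]
    rw [hY₁ s hs, hY₂ s hs]
  · intro s hs h0
    have := hY₂ s hs
    rw [h0, zero_pow two_ne_zero] at this
    exact inv_ne_zero (Zfac_ne_zero hθ hs) this.symm


/-! ### Lemma 5.2's core: `Y′/Y = −½Z′/Z` and the vertical shift of `Y` -/

/-- **Lemma 5.1's second display, pointwise and standalone**: for a primitive `θ` mod `k`, `1 ≤ A`,
`0 < σ ≤ A`, `t ≥ 4A` and `|y| ≤ t/2`,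
`‖(Z′/Z)(σ + i(t+y), θ) + log(kt/2π)‖ ≤ (2|y| + 4A + 10)/t`
("`(Z′/Z)(s+w′,ψ) = −log p + (ϑ′/ϑ)(s+w′) + O(ε) = −log(pt/2π) + O(1/t₀)`").
[cite: Zhang2022LandauSiegel, §5 Lemma 5.1 (proof, second display)] -/
theorem norm_logDeriv_Zfac_add_log_le {θ : DirichletCharacter ℂ k} (hθ : θ.IsPrimitive)
    {A σ t y : ℝ} (hA : 1 ≤ A) (hσ0 : 0 < σ) (hσA : σ ≤ A) (ht : 4 * A ≤ t) (hy : |y| ≤ t / 2) :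
    ‖logDeriv (Zfac θ) ((σ : ℂ) + t * I + y * I) + ((Real.log ((k : ℝ) * t / (2 * π)) : ℝ) : ℂ)‖
      ≤ (2 * |y| + 4 * A + 10) / t := by
  have ht0 : 0 < t := by linarith
  have hk0 : (0 : ℝ) < k := Nat.cast_pos.mpr (Nat.pos_of_ne_zero (NeZero.ne k))
  have hT : t / 2 ≤ t + y := by linarith [neg_abs_le y]
  have hty : 0 < t + y := by linarith
  have hty1 : 1 ≤ t + y := by linarith
  have h2A : 2 * A ≤ t + y := by linarith
  have him : ((σ : ℂ) + t * I + y * I).im = t + y := by simp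
  have hposy : 0 < ((σ : ℂ) + t * I + y * I).im := by rw [him]; exact hty
  have hZ := logDeriv_Zfac_eq hθ hposy
  have hpt : (σ : ℂ) + ((t + y : ℝ) : ℂ) * I = (σ : ℂ) + t * I + y * I := by push_cast; ring
  have hϑy := norm_logDeriv_vartheta_add_log_le hA hσ0 hσA h2A
  rw [hpt] at hϑy
  have hE : ‖logDerivCorr θ ((σ : ℂ) + t * I + y * I)‖ ≤ 2 / (t + y) := by
    refine (norm_logDerivCorr_le θ hposy).trans ?_
    rw [him]
    exact two_pi_div_exp_sub_exp_le hty1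
  have hlog : -Real.log k - Real.log ((t + y) / (2 * π)) + Real.log ((k : ℝ) * t / (2 * π))
      = -Real.log (1 + y / t) := by
    have h2π : (0:ℝ) < 2 * π := by positivity
    rw [Real.log_div hty.ne' h2π.ne', Real.log_div (mul_pos hk0 ht0).ne' h2π.ne',
      Real.log_mul hk0.ne' ht0.ne', show 1 + y / t = (t + y) / t by rw [add_div, div_self ht0.ne'],
      Real.log_div hty.ne' ht0.ne']
    ring
  have hlogC : -((Real.log k : ℝ) : ℂ) - ((Real.log ((t + y) / (2 * π)) : ℝ) : ℂ)
      + ((Real.log ((k : ℝ) * t / (2 * π)) : ℝ) : ℂ) = -((Real.log (1 + y / t) : ℝ) : ℂ) := by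
    have := congrArg (fun r : ℝ => (r : ℂ)) hlog
    simpa only [Complex.ofReal_add, Complex.ofReal_sub, Complex.ofReal_neg] using this
  have hdecomp : logDeriv (Zfac θ) ((σ : ℂ) + t * I + y * I) + ((Real.log ((k : ℝ) * t / (2 * π)) : ℝ) : ℂ)
      = (logDeriv vartheta ((σ : ℂ) + t * I + y * I) + ((Real.log ((t + y) / (2 * π)) : ℝ) : ℂ))
        + logDerivCorr θ ((σ : ℂ) + t * I + y * I) + (-((Real.log (1 + y / t) : ℝ) : ℂ)) := by
    rw [← hlogC, hZ]; ring
  have hℓ : ‖(-((Real.log (1 + y / t) : ℝ) : ℂ))‖ ≤ 2 * |y| / t := by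
    rw [norm_neg, Complex.norm_real, Real.norm_eq_abs]
    have hut : |y / t| ≤ 1 / 2 := by
      rw [abs_div, abs_of_pos ht0, div_le_iff₀ ht0]; linarith
    have hlt : |(-(y / t))| < 1 := by rw [abs_neg]; linarith
    have hm := Real.abs_log_sub_add_sum_range_le hlt 0
    simp only [Finset.sum_range_zero, zero_add, sub_neg_eq_add, abs_neg, pow_one] at hm
    have h2u : |y / t| / (1 - |y / t|) ≤ 2 * |y / t| := by
      rw [div_le_iff₀ (by linarith)]
      nlinarith [mul_nonneg (abs_nonneg (y / t)) (by linarith : (0:ℝ) ≤ 1 / 2 - |y / t|)]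
    refine (hm.trans h2u).trans (le_of_eq ?_)
    rw [abs_div, abs_of_pos ht0, ← mul_div_assoc]
  have h1 : (2 * A + 3) / (t + y) + 2 / (t + y) ≤ (4 * A + 10) / t := by
    rw [← add_div, div_le_div_iff₀ hty ht0]
    nlinarith [mul_nonneg (by linarith : (0:ℝ) ≤ 2 * A + 5) (by linarith : (0:ℝ) ≤ 2 * (t + y) - t)]
  calc ‖logDeriv (Zfac θ) ((σ : ℂ) + t * I + y * I) + ((Real.log ((k : ℝ) * t / (2 * π)) : ℝ) : ℂ)‖
      ≤ ‖logDeriv vartheta ((σ : ℂ) + t * I + y * I) + ((Real.log ((t + y) / (2 * π)) : ℝ) : ℂ)‖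
        + ‖logDerivCorr θ ((σ : ℂ) + t * I + y * I)‖ + ‖(-((Real.log (1 + y / t) : ℝ) : ℂ))‖ := by
        rw [hdecomp]; exact norm_add₃_le
    _ ≤ (2 * A + 3) / (t + y) + 2 / (t + y) + 2 * |y| / t := add_le_add (add_le_add hϑy hE) hℓ
    _ ≤ (2 * |y| + 4 * A + 10) / t := by
        rw [show (2 * |y| + 4 * A + 10) / t = (4 * A + 10) / t + 2 * |y| / t by ring]
        linarith

/-- **`Y′/Y = −½·Z′/Z`** on the upper half-plane, for any analytic square root `Y` of `Z(·,θ)⁻¹`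
there (the first equality of "`(Y′/Y)(s+w,ψ) = −½(Z′/Z)(s+w,ψ) = ½log(pt₀) + O(ι^{−114})`" in the
proof of Lemma 5.2). [cite: Zhang2022LandauSiegel, §5 Lemma 5.2 (proof)] -/
theorem logDeriv_sqrt_inv_Zfac {θ : DirichletCharacter ℂ k} {Y : ℂ → ℂ}
    (hYd : DifferentiableOn ℂ Y {s : ℂ | 0 < s.im}) (hY : ∀ s : ℂ, 0 < s.im → Y s ^ 2 = (Zfac θ s)⁻¹)
    {s : ℂ} (hs : 0 < s.im) : logDeriv Y s = -(1 / 2) * logDeriv (Zfac θ) s := by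
  have hUo : IsOpen {s : ℂ | 0 < s.im} := isOpen_lt continuous_const Complex.continuous_im
  have hmem := hUo.mem_nhds hs
  have hYa : DifferentiableAt ℂ Y s := hYd.differentiableAt hmem
  have hE : (fun z => Y z ^ 2) =ᶠ[𝓝 s] fun z => Zfac θ z ^ (-1 : ℤ) := by
    filter_upwards [hmem] with z hz
    rw [hY z hz, zpow_neg_one]
  have h1 : logDeriv (fun z => Y z ^ 2) s = 2 * logDeriv Y s := by
    exact_mod_cast logDeriv_fun_pow hYa 2
  have h2 : logDeriv (fun z => Zfac θ z ^ (-1 : ℤ)) s = -logDeriv (Zfac θ) s := by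
    rw [logDeriv_fun_zpow (differentiableAt_Zfac θ hs)]; push_cast; ring
  have h3 : logDeriv (fun z => Y z ^ 2) s = logDeriv (fun z => Zfac θ z ^ (-1 : ℤ)) s := by
    rw [logDeriv_apply, logDeriv_apply, hE.deriv_eq, hE.eq_of_nhds]
  have : 2 * logDeriv Y s = -logDeriv (Zfac θ) s := by rw [← h1, h3, h2]
  linear_combination (1 / 2 : ℂ) * this

/-- **Lemma 5.2's shift of `Y`, made exact** ("`Y(s+β_j,ψ)/Y(s,ψ) = exp(∫₀^{β_j}(Y′/Y)(s+w,ψ)dw) =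
(pt₀)^{β_j/2}(1 + O(ι^{−123}))`", for purely imaginary `β = iv` as in (2.13)): for a primitive `θ`
mod `k`, an analytic square root `Y` of `Z(·,θ)⁻¹` on the upper half-plane, `1 ≤ A`, `0 < σ ≤ A`,
`t ≥ 4A`, `|v| ≤ t/2`:
`Y(σ+it+iv) = Y(σ+it)·e^{+iv·log(kt/2π)/2}·e^{η}`, `‖η‖ ≤ (2|v| + 4A + 10)|v|/(2t)`.
[cite: Zhang2022LandauSiegel, §5 Lemma 5.2 (proof)] -/
theorem sqrt_inv_Zfac_vertical_shift {θ : DirichletCharacter ℂ k} (hθ : θ.IsPrimitive) {Y : ℂ → ℂ}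
    (hYd : DifferentiableOn ℂ Y {s : ℂ | 0 < s.im}) (hY : ∀ s : ℂ, 0 < s.im → Y s ^ 2 = (Zfac θ s)⁻¹)
    {A σ t v : ℝ} (hA : 1 ≤ A) (hσ0 : 0 < σ) (hσA : σ ≤ A) (ht : 4 * A ≤ t) (hv : |v| ≤ t / 2) :
    ∃ η : ℂ, ‖η‖ ≤ (2 * |v| + 4 * A + 10) * |v| / (2 * t) ∧
      Y ((σ : ℂ) + t * I + v * I)
        = Y ((σ : ℂ) + t * I)
          * cexp ((v : ℂ) * ((Real.log ((k : ℝ) * t / (2 * π)) : ℝ) : ℂ) / 2 * I) * cexp η := by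
  have ht0 : 0 < t := by linarith
  have hUo : IsOpen {s : ℂ | 0 < s.im} := isOpen_lt continuous_const Complex.continuous_im
  set s : ℂ := (σ : ℂ) + t * I with hs_def
  have him : ∀ y : ℝ, (s + y * I).im = t + y := by intro y; simp [hs_def]
  have hyv : ∀ y : ℝ, |y| ≤ |v| → t / 2 ≤ t + y := by
    intro y hy; linarith [neg_abs_le y]
  have hpos : ∀ y : ℝ, |y| ≤ |v| → 0 < (s + y * I).im := by
    intro y hy; rw [him]; linarith [hyv y hy]
  have hIcc : ∀ y ∈ Icc (min 0 v) (max 0 v), |y| ≤ |v| := by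
    intro y hy
    rcases le_total 0 v with h0v | hv0
    · rw [min_eq_left h0v, max_eq_right h0v] at hy
      rw [abs_of_nonneg hy.1, abs_of_nonneg h0v]; exact hy.2
    · rw [min_eq_right hv0, max_eq_left hv0] at hy
      rw [abs_of_nonpos hy.2, abs_of_nonpos hv0]; linarith [hy.1]
  have hIoc : ∀ y ∈ Set.uIoc (0:ℝ) v, |y| ≤ |v| := by
    intro y hy
    rw [Set.uIoc, Set.mem_Ioc] at hy
    exact hIcc y ⟨hy.1.le, hy.2⟩
  have hY0 : ∀ z : ℂ, 0 < z.im → Y z ≠ 0 := by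
    intro z hz h0
    have := hY z hz
    rw [h0, zero_pow two_ne_zero] at this
    exact inv_ne_zero (Zfac_ne_zero hθ hz) this.symm
  have han : ∀ y ∈ Icc (min 0 v) (max 0 v), AnalyticAt ℂ Y (s + y * I) :=
    fun y hy => hYd.analyticAt (hUo.mem_nhds (hpos y (hIcc y hy)))
  have hne : ∀ y ∈ Icc (min 0 v) (max 0 v), Y (s + y * I) ≠ 0 :=
    fun y hy => hY0 _ (hpos y (hIcc y hy))
  have hanZ : ∀ y ∈ Icc (min 0 v) (max 0 v), AnalyticAt ℂ (Zfac θ) (s + y * I) :=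
    fun y hy => analyticAt_Zfac θ (hpos y (hIcc y hy))
  have hneZ : ∀ y ∈ Icc (min 0 v) (max 0 v), Zfac θ (s + y * I) ≠ 0 :=
    fun y hy => Zfac_ne_zero hθ (hpos y (hIcc y hy))
  have h0mem : (0:ℝ) ∈ Icc (min 0 v) (max 0 v) := ⟨min_le_left _ _, le_max_left _ _⟩
  have hvmem : v ∈ Icc (min 0 v) (max 0 v) := ⟨min_le_right _ _, le_max_right _ _⟩
  have key := eq_mul_exp_I_mul_integral_logDeriv han hne h0mem hvmem
  have hs0 : s + ((0:ℝ) : ℂ) * I = s := by simp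
  rw [hs0] at key
  set f : ℝ → ℂ := fun y => deriv (Zfac θ) (s + y * I) / Zfac θ (s + y * I) with hf_def
  set L : ℂ := ((Real.log ((k : ℝ) * t / (2 * π)) : ℝ) : ℂ) with hL_def
  -- the integrand of `key` is `−½ f`
  have hint : ∫ y in (0:ℝ)..v, deriv Y (s + y * I) / Y (s + y * I)
      = -(1 / 2) * ∫ y in (0:ℝ)..v, f y := by
    rw [← intervalIntegral.integral_const_mul]
    refine intervalIntegral.integral_congr (fun y hy => ?_)
    have hy' : y ∈ Icc (min 0 v) (max 0 v) := by
      rcases le_total 0 v with h | h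
      · rw [uIcc_of_le h] at hy; rwa [min_eq_left h, max_eq_right h]
      · rw [uIcc_of_ge h] at hy; rwa [min_eq_right h, max_eq_left h]
    show deriv Y (s + y * I) / Y (s + y * I)
      = -(1 / 2) * (deriv (Zfac θ) (s + y * I) / Zfac θ (s + y * I))
    rw [← logDeriv_apply, ← logDeriv_apply]
    exact logDeriv_sqrt_inv_Zfac hYd hY (hpos y (hIcc y hy'))
  -- continuity ⇒ integrability of `f`
  have hcont : ContinuousOn f (uIcc 0 v) := by
    rw [hf_def]
    intro y hy
    have hy' : y ∈ Icc (min 0 v) (max 0 v) := by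
      rcases le_total 0 v with h | h
      · rw [uIcc_of_le h] at hy; rwa [min_eq_left h, max_eq_right h]
      · rw [uIcc_of_ge h] at hy; rwa [min_eq_right h, max_eq_left h]
    have haff : ContinuousAt (fun y : ℝ => s + (y : ℂ) * I) y := by fun_prop
    have hAy := hanZ y hy'
    have h1 : ContinuousAt (fun y : ℝ => deriv (Zfac θ) (s + (y : ℂ) * I)) y :=
      hAy.deriv.continuousAt.comp_of_eq haff rfl
    have h2 : ContinuousAt (fun y : ℝ => Zfac θ (s + (y : ℂ) * I)) y :=
      hAy.continuousAt.comp_of_eq haff rfl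
    exact (h1.div h2 (hneZ y hy')).continuousWithinAt
  have hii : IntervalIntegrable f volume 0 v := hcont.intervalIntegrable
  have hsplit : ∫ y in (0:ℝ)..v, f y = (∫ y in (0:ℝ)..v, (f y + L)) - v * L := by
    rw [intervalIntegral.integral_add hii intervalIntegrable_const,
      intervalIntegral.integral_const, sub_zero, Complex.real_smul]
    ring
  have hRb : ∀ y : ℝ, |y| ≤ |v| → ‖f y + L‖ ≤ (2 * |v| + 4 * A + 10) / t := by
    intro y hy
    have hb := norm_logDeriv_Zfac_add_log_le hθ hA hσ0 hσA ht (hy.trans hv)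
    have hfy : f y = logDeriv (Zfac θ) ((σ : ℂ) + t * I + y * I) := by
      simp only [hf_def, logDeriv_apply, hs_def]
    rw [hfy, hL_def]
    refine hb.trans ?_
    gcongr
  refine ⟨-(I / 2) * ∫ y in (0:ℝ)..v, (f y + L), ?_, ?_⟩
  · rw [norm_mul, norm_neg, norm_div, Complex.norm_I, Complex.norm_two]
    have hb := intervalIntegral.norm_integral_le_of_norm_le_const (a := (0:ℝ)) (b := v)
      (f := fun y => f y + L) (C := (2 * |v| + 4 * A + 10) / t) (fun y hy => hRb y (hIoc y hy))
    rw [sub_zero] at hb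
    calc 1 / 2 * ‖∫ y in (0:ℝ)..v, f y + L‖ ≤ 1 / 2 * ((2 * |v| + 4 * A + 10) / t * |v|) := by
          gcongr
      _ = (2 * |v| + 4 * A + 10) * |v| / (2 * t) := by ring
  · rw [key, hint, hsplit]
    have : I * (-(1 / 2) * ((∫ y in (0:ℝ)..v, (f y + L)) - v * L))
        = v * L / 2 * I + -(I / 2) * ∫ y in (0:ℝ)..v, (f y + L) := by ring
    rw [this, Complex.exp_add]
    ring

/-- **Lemma 5.2's product, made exact** ("`Y(s+β₁,ψ)Y(s+β₂,ψ)Y(s+β₃,ψ)/Y(s,ψ) =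
(pt₀)^{β₃}Z(s,ψ)⁻¹(1 + O(ι^{−123}))`", via "`(β₁+β₂+β₃)/2 = β₃`"): for purely imaginary shifts
`iv₁, iv₂, iv₃` with `|v_j| ≤ t/2` (hypotheses as in `sqrt_inv_Zfac_vertical_shift`),
`Y(s+iv₁)Y(s+iv₂)Y(s+iv₃)/Y(s) = Z(s,θ)⁻¹·e^{i(v₁+v₂+v₃)log(kt/2π)/2}·e^{η}` with
`‖η‖ ≤ Σ_j (2|v_j|+4A+10)|v_j|/(2t)`. [cite: Zhang2022LandauSiegel, §5 Lemma 5.2 (proof)] -/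
theorem sqrt_inv_Zfac_triple_shift {θ : DirichletCharacter ℂ k} (hθ : θ.IsPrimitive) {Y : ℂ → ℂ}
    (hYd : DifferentiableOn ℂ Y {s : ℂ | 0 < s.im}) (hY : ∀ s : ℂ, 0 < s.im → Y s ^ 2 = (Zfac θ s)⁻¹)
    {A σ t v₁ v₂ v₃ : ℝ} (hA : 1 ≤ A) (hσ0 : 0 < σ) (hσA : σ ≤ A) (ht : 4 * A ≤ t)
    (hv₁ : |v₁| ≤ t / 2) (hv₂ : |v₂| ≤ t / 2) (hv₃ : |v₃| ≤ t / 2) :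
    ∃ η : ℂ, ‖η‖ ≤ ((2 * |v₁| + 4 * A + 10) * |v₁| + (2 * |v₂| + 4 * A + 10) * |v₂|
        + (2 * |v₃| + 4 * A + 10) * |v₃|) / (2 * t) ∧
      Y ((σ : ℂ) + t * I + v₁ * I) * Y ((σ : ℂ) + t * I + v₂ * I) * Y ((σ : ℂ) + t * I + v₃ * I)
          / Y ((σ : ℂ) + t * I)
        = (Zfac θ ((σ : ℂ) + t * I))⁻¹
          * cexp (((v₁ + v₂ + v₃ : ℝ) : ℂ) * ((Real.log ((k : ℝ) * t / (2 * π)) : ℝ) : ℂ) / 2 * I)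
          * cexp η := by
  have ht0 : 0 < t := by linarith
  obtain ⟨η₁, hη₁, h₁⟩ := sqrt_inv_Zfac_vertical_shift hθ hYd hY hA hσ0 hσA ht hv₁
  obtain ⟨η₂, hη₂, h₂⟩ := sqrt_inv_Zfac_vertical_shift hθ hYd hY hA hσ0 hσA ht hv₂
  obtain ⟨η₃, hη₃, h₃⟩ := sqrt_inv_Zfac_vertical_shift hθ hYd hY hA hσ0 hσA ht hv₃
  have hs : 0 < ((σ : ℂ) + t * I).im := by simpa using ht0
  have hY0 : Y ((σ : ℂ) + t * I) ≠ 0 := by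
    intro h0
    have := hY _ hs
    rw [h0, zero_pow two_ne_zero] at this
    exact inv_ne_zero (Zfac_ne_zero hθ hs) this.symm
  refine ⟨η₁ + η₂ + η₃, ?_, ?_⟩
  · calc ‖η₁ + η₂ + η₃‖ ≤ ‖η₁‖ + ‖η₂‖ + ‖η₃‖ := norm_add₃_le
      _ ≤ (2 * |v₁| + 4 * A + 10) * |v₁| / (2 * t) + (2 * |v₂| + 4 * A + 10) * |v₂| / (2 * t)
          + (2 * |v₃| + 4 * A + 10) * |v₃| / (2 * t) := add_le_add (add_le_add hη₁ hη₂) hη₃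
      _ = _ := by ring
  · set L : ℂ := ((Real.log ((k : ℝ) * t / (2 * π)) : ℝ) : ℂ) with hL_def
    set Y0 : ℂ := Y ((σ : ℂ) + t * I) with hY0_def
    rw [h₁, h₂, h₃]
    have hexp : cexp ((v₁ : ℂ) * L / 2 * I) * cexp η₁ * (cexp ((v₂ : ℂ) * L / 2 * I) * cexp η₂)
        * (cexp ((v₃ : ℂ) * L / 2 * I) * cexp η₃)
        = cexp (((v₁ + v₂ + v₃ : ℝ) : ℂ) * L / 2 * I) * cexp (η₁ + η₂ + η₃) := by
      rw [Complex.exp_add, Complex.exp_add, show ((v₁ + v₂ + v₃ : ℝ) : ℂ) * L / 2 * I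
        = (v₁ : ℂ) * L / 2 * I + (v₂ : ℂ) * L / 2 * I + (v₃ : ℂ) * L / 2 * I by push_cast; ring,
        Complex.exp_add, Complex.exp_add]
      ring
    calc Y0 * cexp ((v₁ : ℂ) * L / 2 * I) * cexp η₁ * (Y0 * cexp ((v₂ : ℂ) * L / 2 * I) * cexp η₂)
          * (Y0 * cexp ((v₃ : ℂ) * L / 2 * I) * cexp η₃) / Y0
        = Y0 ^ 2 * (cexp ((v₁ : ℂ) * L / 2 * I) * cexp η₁ * (cexp ((v₂ : ℂ) * L / 2 * I) * cexp η₂)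
          * (cexp ((v₃ : ℂ) * L / 2 * I) * cexp η₃)) := by
          field_simp
      _ = (Zfac θ ((σ : ℂ) + t * I))⁻¹ * cexp (((v₁ + v₂ + v₃ : ℝ) : ℂ) * L / 2 * I)
          * cexp (η₁ + η₂ + η₃) := by
          rw [hexp, hY0_def, hY _ hs]; ring

end Literature.NumberTheory.LFunctions.Zhang2022.GammaFactor
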